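import Mathlib
import Summits.Ventures.LatticeQCDFlow.Scoring.CalibrationTruths
import Summits.Ventures.LatticeQCDFlow.Scoring.MadrasSokalWindow
import Summits.Ventures.LatticeQCDFlow.Scoring.LagProductCovariance
import Summits.Ventures.LatticeQCDFlow.Scoring.FejerPairSums
import Summits.Ventures.LatticeQCDFlow.Scoring.BartlettKernel
import HarnessLib

/-!
# The Madras–Sokal error bar, derived: `N · Var(τ̂_W) → V(W) = Σ_{s,t=1}^{W} B(s,t)` and `V(W)/W → 4 τ_int²`, so the printed `δτ = τ √((4W+2)/N)` is the large-window asymptote; for `ρ ≥ 0`, `V(W) ≤ 4 W τ_int²` at EVERY window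

HONEST FRAMING: exact (Metropolis-corrected) sampling algorithms for lattice gauge theory;
figures of merit are autocorrelation/cost numbers at stated couplings and volumes; no
continuum-physics claim.

Venture `LatticeQCDFlow` (cell pub-lqcd), sub-topic `Scoring`; FANOUT row 16 (`su2-base`), GEN-6.
NEW WORK of the cell over this packet's `LagProductCovariance` / `FejerPairSums` / `BartlettKernel`
and the tree's `CalibrationTruths.tauInt`, `MadrasSokalWindow.msDTau` (scorer B's printed bar
`δτ_B = τ √((4W+2)/N)`, row 16's acceptance (d) 'errors on τ_int ≤ 15 %').  Nothing is cited as a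
fact.  Printed counterparts, NAMED ONLY: Madras–Sokal, J. Stat. Phys. 50 (1988) 109, App. C
(`Var τ̂ ≈ (2(2W+1)/N) τ²` for `τ ≪ W ≪ N`); Wolff, CPC 156 (2004) 143, §3.3 eq. (42); Priestley 1981
§5.3.

Fourth file of the ERROR-OF-THE-ERROR packet: the formula behind the bar.  For a normalised
autocorrelation function `ρ : ℕ → ℝ` (`ρ 0 = 1`, summable), even extension `ρ̄`, `K = acfConv ρ̄`,
`B(s,t) = K(t−s) + K(t+s)` (`bartlettKernel`), `τ = tauInt ρ = ½ Σ_ℤ ρ̄`: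

* `tauHatLin X σ² N W = ½ + Σ_{t=1}^{W} Γ̂_N(t)/σ²` — the windowed estimator with KNOWN
  normalisation `σ² = C(0)` (the ratio `Γ̂(t)/Γ̂(0)` of the real estimator is linearised in
  `MadrasSokalRatioVariance.lean`; same leading order);
  `tauHatAVar ρ W = V(W) = Σ_{s<W} Σ_{t<W} B(s+1, t+1)` — its asymptotic variance functional;
  **`IsWickFamily.tendsto_variance_tauHatLin`** — for a stationary Wick family with covariance
  `σ² ρ̄` (`σ² ≠ 0`): `N · Var[τ̂_W] → V(W)` as `N → ∞`, every `W` (Bartlett's formula summed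
  over the window).
* **`tendsto_tauHatAVar_div`** — THE MADRAS–SOKAL FORMULA: `V(W)/W → 4 τ_int²` as `W → ∞` (the
  diagonal part `Σ_{s,t} K(t−s)` is a Fejér pair sum `→ W Σ_ℤ K = W (Σ_ℤ ρ̄)² = 4Wτ²`; the exchange
  part `Σ_{s,t} K(s+t+2)` is `o(W)` — `FejerPairSums`); NO moment condition beyond `Σ|ρ| < ∞`;
  **`tendsto_tauHatAVar_div_printed`** — equivalently `V(W) / ((4W + 2) τ²) → 1`, and
  `natCast_mul_msDTau_sq`: `(4W+2)τ² = N · δτ_B²`: the printed bar IS the large-window asymptote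
  of the Gaussian-model standard deviation of `τ̂_W`, `δτ_B² · (1 + o(1))` as `τ ≪ W ≪ N`.
* **`tauHatAVar_le`** — if moreover `ρ ≥ 0` (every autocorrelation non-negative: set C-1 `r^t`,
  its positive mixtures C-1b, any reversible positive chain) then `V(W) ≤ 4 W τ²` for EVERY `W ≥ 0`
  — so `V(W) < (4W+2)τ² = N δτ_B²` (`tauHatAVar_lt_printed`): at EVERY window (not only as
  `W → ∞`) the printed bar exceeds the `N → ∞` Gaussian-model standard deviation `√(V(W)/N)` of
  the known-normalisation estimator.  Row lemma `sum_bartlettKernel_row_le`: each row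
  `Σ_{t<W} B(s+1,t+1)` visits every lag of `K ≥ 0` at most once after folding the exchange lags to
  the negative side, hence is `≤ Σ_ℤ K`.

NOT CLAIMED: a CLT or any finite-`N` distributional statement for `τ̂_W` (only its variance);
the ratio normalisation (next file); the coupling between the automatic window `W(τ̂)` and `τ̂`;
non-Gaussian fourth cumulants; that `ρ ≥ 0` holds for HMC (it need not).
-/

noncomputable section

open MeasureTheory ProbabilityTheory Finset Filter Topology

namespace Summit.Ventures.LatticeQCDFlow.Scoring

variable {Ω : Type*} {mΩ : MeasurableSpace Ω} {μ : Measure Ω}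

/-! ## The estimator and its asymptotic variance functional -/

/-- The windowed integrated-autocorrelation-time estimator with KNOWN normalisation:
`τ̂_W = ½ + Σ_{t=1}^{W} Γ̂_N(t)/σ²`. [ours] -/
def tauHatLin (X : ℕ → Ω → ℝ) (σ2 : ℝ) (N W : ℕ) : Ω → ℝ :=
  fun ω => 1 / 2 + (∑ t ∈ range W, acovHat X N (t + 1) ω) / σ2

/-- `V(W) = Σ_{s<W} Σ_{t<W} B(s+1, t+1)`: the `N → ∞` limit of `N · Var[τ̂_W]` for a normalised
autocorrelation function `ρ` (`tendsto_variance_tauHatLin`). [ours] -/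
def tauHatAVar (ρ : ℕ → ℝ) (W : ℕ) : ℝ :=
  ∑ s ∈ range W, ∑ t ∈ range W, bartlettKernel (evenExt ρ) (s + 1) (t + 1)

/-- `B(s+1, t+1) = K(t − s) + K(s + t + 2)`: the diagonal and the exchange lag. -/
theorem bartlettKernel_succ_succ (c : ℤ → ℝ) (s t : ℕ) :
    bartlettKernel c (s + 1) (t + 1) = acfConv c ((t : ℤ) - s) + acfConv c ((s + t + 2 : ℕ) : ℤ) := by
  rw [bartlettKernel_def]
  congr 2
  · push_cast
    ring
  · push_cast
    ring

/-- `V(W)` split into its diagonal (Fejér) part and its exchange part. -/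
theorem tauHatAVar_eq_add (ρ : ℕ → ℝ) (W : ℕ) :
    tauHatAVar ρ W
      = (∑ s ∈ range W, ∑ t ∈ range W, acfConv (evenExt ρ) ((t : ℤ) - s))
        + ∑ s ∈ range W, ∑ t ∈ range W, acfConv (evenExt ρ) ((s + t + 2 : ℕ) : ℤ) := by
  rw [tauHatAVar, ← sum_add_distrib]
  refine sum_congr rfl fun s _ => ?_
  rw [← sum_add_distrib]
  exact sum_congr rfl fun t _ => bartlettKernel_succ_succ _ s t

/-! ## `N · Var[τ̂_W] → V(W)` (Bartlett summed over the window) -/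

namespace IsWickFamily

variable [IsProbabilityMeasure μ] {X : ℕ → Ω → ℝ} {C : ℕ → ℕ → ℝ} {ρ : ℕ → ℝ} {σ2 : ℝ}

/-- **`N · Var[τ̂_W] → V(W)`** for a stationary Wick family with covariance `C i j = σ² ρ̄(j − i)`,
`σ² ≠ 0`, `Σ|ρ| < ∞` — at every fixed window `W`. -/
theorem tendsto_variance_tauHatLin (h : IsWickFamily X C μ)
    (hC : ∀ i j, C i j = σ2 * evenExt ρ ((j : ℤ) - i)) (hσ : σ2 ≠ 0) (hρ : Summable ρ) (W : ℕ) :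
    Tendsto (fun N : ℕ => (N : ℝ) * Var[tauHatLin X σ2 N W; μ]) atTop (𝓝 (tauHatAVar ρ W)) := by
  set c : ℤ → ℝ := fun m => σ2 * evenExt ρ m with hc_def
  have hc : Summable c := (summable_evenExt hρ).mul_left σ2
  have hC' : ∀ i j, C i j = c ((j : ℤ) - i) := fun i j => by rw [hC]
  -- the variance as a double sum of covariances
  have hvar : ∀ N : ℕ, Var[tauHatLin X σ2 N W; μ]
      = (∑ s ∈ range W, ∑ t ∈ range W,
          cov[acovHat X N (s + 1), acovHat X N (t + 1); μ]) / σ2 / σ2 := by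
    intro N
    have hS : MemLp (fun ω => ∑ t ∈ range W, acovHat X N (t + 1) ω) 2 μ :=
      memLp_finsetSum _ fun t _ => h.memLp_acovHat N (t + 1)
    have hI : Integrable (fun ω => (∑ t ∈ range W, acovHat X N (t + 1) ω) / σ2) μ :=
      (hS.integrable one_le_two).div_const _
    rw [← covariance_self (by
      exact (hI.aestronglyMeasurable.aemeasurable.const_add (1 / 2)))]
    unfold tauHatLin
    rw [covariance_const_add_left hI, covariance_const_add_right hI, covariance_fun_div_left,
      covariance_fun_div_right,
      covariance_fun_sum_fun_sum' (fun s _ => h.memLp_acovHat N (s + 1))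
        (fun t _ => h.memLp_acovHat N (t + 1))]
  -- limits termwise
  have hlim : Tendsto (fun N : ℕ => (∑ s ∈ range W, ∑ t ∈ range W,
      (N : ℝ) * cov[acovHat X N (s + 1), acovHat X N (t + 1); μ]) / σ2 / σ2) atTop
      (𝓝 ((∑ s ∈ range W, ∑ t ∈ range W, bartlettKernel c (s + 1) (t + 1)) / σ2 / σ2)) := by
    refine ((tendsto_finsetSum _ fun s _ => tendsto_finsetSum _ fun t _ => ?_).div_const _).div_const _
    exact h.tendsto_covariance_acovHat' hC' hc (s + 1) (t + 1)
  have hval : (∑ s ∈ range W, ∑ t ∈ range W, bartlettKernel c (s + 1) (t + 1)) / σ2 / σ2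
      = tauHatAVar ρ W := by
    simp only [hc_def, bartlettKernel_const_mul, tauHatAVar, ← mul_sum]
    field_simp
  rw [← hval]
  refine hlim.congr fun N => ?_
  rw [hvar N, ← mul_div_assoc, ← mul_div_assoc, mul_sum]
  simp_rw [mul_sum]

end IsWickFamily

/-! ## The Madras–Sokal asymptote `V(W)/W → 4 τ_int²` -/

/-- `Σ_{u∈ℤ} K(u) = 4 τ_int²` for a summable normalised autocorrelation function. -/
theorem tsum_acfConv_evenExt {ρ : ℕ → ℝ} (hρ : Summable ρ) (h0 : ρ 0 = 1) :
    ∑' u, acfConv (evenExt ρ) u = 4 * tauInt ρ ^ 2 := by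
  rw [tsum_acfConv (summable_evenExt hρ), tsum_evenExt hρ h0]
  ring

/-- **The Madras–Sokal formula.**  For a summable normalised autocorrelation function
(`ρ 0 = 1`, `Σ|ρ| < ∞`): `V(W)/W → 4 τ_int²` as `W → ∞`, i.e. `N · Var[τ̂_W] ≈ 4 W τ_int²
≈ (4W + 2) τ_int²` for `τ ≪ W ≪ N`.  The diagonal part is a Fejér pair sum of `K`
(`→ Σ_ℤ K = (Σ_ℤ ρ̄)² = 4τ²` per unit window), the exchange part is `o(W)`. -/
theorem tendsto_tauHatAVar_div {ρ : ℕ → ℝ} (hρ : Summable ρ) (h0 : ρ 0 = 1) :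
    Tendsto (fun W : ℕ => tauHatAVar ρ W / W) atTop (𝓝 (4 * tauInt ρ ^ 2)) := by
  have hK : Summable (acfConv (evenExt ρ)) := summable_acfConv (summable_evenExt hρ)
  have h1 := tendsto_sum_sum_int_sub_div hK
  have h2 := tendsto_sum_sum_add_div (u := fun n : ℕ => acfConv (evenExt ρ) n)
    (summable_nat_of_summable_int hK) 2
  rw [← tsum_acfConv_evenExt hρ h0, ← add_zero (∑' u, acfConv (evenExt ρ) u)]
  refine (h1.add h2).congr fun W => ?_
  rw [← add_div, ← tauHatAVar_eq_add]

/-- **The printed bar is the large-window asymptote**: `V(W) / ((4W + 2) τ_int²) → 1` as `W → ∞`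
(`τ_int ≠ 0`). -/
theorem tendsto_tauHatAVar_div_printed {ρ : ℕ → ℝ} (hρ : Summable ρ) (h0 : ρ 0 = 1)
    (hτ : tauInt ρ ≠ 0) :
    Tendsto (fun W : ℕ => tauHatAVar ρ W / ((4 * W + 2) * tauInt ρ ^ 2)) atTop (𝓝 1) := by
  have hA := tendsto_tauHatAVar_div hρ h0
  -- `(4W + 2) τ² / W → 4 τ²`
  have hB : Tendsto (fun W : ℕ => (4 * (W : ℝ) + 2) * tauInt ρ ^ 2 / W) atTop
      (𝓝 (4 * tauInt ρ ^ 2)) := by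
    have h2 : Tendsto (fun W : ℕ => (2 : ℝ) * tauInt ρ ^ 2 / W) atTop (𝓝 0) :=
      tendsto_const_div_atTop_nhds_zero_nat _
    have := (tendsto_const_nhds (x := 4 * tauInt ρ ^ 2)).add h2
    rw [add_zero] at this
    refine this.congr' ?_
    filter_upwards [eventually_ne_atTop 0] with W hW
    have : (W : ℝ) ≠ 0 := Nat.cast_ne_zero.mpr hW
    field_simp
  have hne : (4 : ℝ) * tauInt ρ ^ 2 ≠ 0 := by positivity
  have := hA.div hB hne
  rw [div_self hne] at this
  refine this.congr' ?_
  filter_upwards [eventually_ne_atTop 0] with W hW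
  have hW' : (W : ℝ) ≠ 0 := Nat.cast_ne_zero.mpr hW
  simp only [Pi.div_apply]
  rw [div_div_div_cancel_right₀ hW']

/-- The printed bar in the variance scale: `N · δτ_B² = (4W + 2) τ²` (`msDTau τ W N = τ √((4W+2)/N)`,
scorer B; `MadrasSokalWindow.msDTau`), for `N > 0`, `W ≥ 0`. -/
theorem natCast_mul_msDTau_sq {τ W N : ℝ} (hW : 0 ≤ W) (hN : 0 < N) :
    N * msDTau τ W N ^ 2 = (4 * W + 2) * τ ^ 2 := by
  unfold msDTau
  rw [mul_pow, Real.sq_sqrt (div_nonneg (by linarith) hN.le)]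
  field_simp

/-- Hence `V(W) / (N δτ_B²) → 1` as `W → ∞` at any fixed `N > 0`: to leading order in the window,
the printed Madras–Sokal bar squared IS `Var[τ̂_W]` in the Gaussian model. -/
theorem tendsto_tauHatAVar_div_msDTau_sq {ρ : ℕ → ℝ} (hρ : Summable ρ) (h0 : ρ 0 = 1)
    (hτ : tauInt ρ ≠ 0) {N : ℝ} (hN : 0 < N) :
    Tendsto (fun W : ℕ => tauHatAVar ρ W / (N * msDTau (tauInt ρ) W N ^ 2)) atTop (𝓝 1) := by
  refine (tendsto_tauHatAVar_div_printed hρ h0 hτ).congr fun W => ?_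
  rw [natCast_mul_msDTau_sq (Nat.cast_nonneg W) hN]

/-! ## Non-negative autocorrelations: `V(W) ≤ 4 W τ_int²` at every window -/

/-- **Row lemma.**  For `c ≥ 0` summable, every row of the window sum is at most the full mass of
`K`: `Σ_{t<W} B(s+1, t+1) ≤ Σ_{u∈ℤ} K(u)`.  (The diagonal lags `t − s ∈ [−s, W−1−s]` and the
exchange lags folded to `−(s+t+2) ∈ [−(W+s+1), −(s+2)]` are pairwise distinct integers, and
`K ≥ 0`.) -/
theorem sum_bartlettKernel_row_le {c : ℤ → ℝ} (hc : Summable c) (hc0 : ∀ m, 0 ≤ c m) (s W : ℕ) :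
    ∑ t ∈ range W, bartlettKernel c (s + 1) (t + 1) ≤ ∑' u, acfConv c u := by
  have hK : Summable (acfConv c) := summable_acfConv hc
  have hK0 : ∀ u, 0 ≤ acfConv c u := acfConv_nonneg hc0
  -- the two lag maps
  set f₁ : ℕ → ℤ := fun t => (t : ℤ) - s with hf₁
  set f₂ : ℕ → ℤ := fun t => -((s + t + 2 : ℕ) : ℤ) with hf₂
  have hinj₁ : Set.InjOn f₁ (range W : Finset ℕ) := fun a _ b _ h => by
    simp only [hf₁] at h
    omega
  have hinj₂ : Set.InjOn f₂ (range W : Finset ℕ) := fun a _ b _ h => by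
    simp only [hf₂] at h
    omega
  have hdisj : Disjoint ((range W).image f₁) ((range W).image f₂) := by
    rw [disjoint_left]
    intro u hu₁ hu₂
    obtain ⟨a, -, rfl⟩ := mem_image.mp hu₁
    obtain ⟨b, -, hb⟩ := mem_image.mp hu₂
    simp only [hf₁, hf₂] at hb
    omega
  calc ∑ t ∈ range W, bartlettKernel c (s + 1) (t + 1)
      = ∑ t ∈ range W, acfConv c (f₁ t) + ∑ t ∈ range W, acfConv c (f₂ t) := by
        rw [← sum_add_distrib]
        refine sum_congr rfl fun t _ => ?_
        rw [bartlettKernel_succ_succ, hf₁, hf₂]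
        simp only
        rw [acfConv_neg]
    _ = ∑ u ∈ (range W).image f₁, acfConv c u + ∑ u ∈ (range W).image f₂, acfConv c u := by
        rw [sum_image hinj₁, sum_image hinj₂]
    _ = ∑ u ∈ (range W).image f₁ ∪ (range W).image f₂, acfConv c u := (sum_union hdisj).symm
    _ ≤ ∑' u, acfConv c u := hK.sum_le_tsum _ fun u _ => hK0 u

/-- **`V(W) ≤ 4 W τ_int²` for non-negative autocorrelations**, at EVERY window `W`. -/
theorem tauHatAVar_le {ρ : ℕ → ℝ} (hρ : Summable ρ) (h0 : ρ 0 = 1) (hnn : ∀ t, 0 ≤ ρ t) (W : ℕ) :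
    tauHatAVar ρ W ≤ 4 * W * tauInt ρ ^ 2 := by
  have hc0 : ∀ m, 0 ≤ evenExt ρ m := fun m => hnn _
  calc tauHatAVar ρ W ≤ ∑ _s ∈ range W, ∑' u, acfConv (evenExt ρ) u :=
        sum_le_sum fun s _ => sum_bartlettKernel_row_le (summable_evenExt hρ) hc0 s W
    _ = 4 * W * tauInt ρ ^ 2 := by
        rw [sum_const, card_range, nsmul_eq_mul, tsum_acfConv_evenExt hρ h0]
        ring

/-- Hence `V(W) < (4W + 2) τ_int² = N δτ_B²` whenever `ρ ≥ 0` and `τ_int ≠ 0`: at every window the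
printed bar over-covers the Gaussian-model fluctuation of the known-normalisation estimator. -/
theorem tauHatAVar_lt_printed {ρ : ℕ → ℝ} (hρ : Summable ρ) (h0 : ρ 0 = 1) (hnn : ∀ t, 0 ≤ ρ t)
    (hτ : tauInt ρ ≠ 0) (W : ℕ) :
    tauHatAVar ρ W < (4 * W + 2) * tauInt ρ ^ 2 := by
  have := tauHatAVar_le hρ h0 hnn W
  have hτ2 : 0 < tauInt ρ ^ 2 := by positivity
  nlinarith

/-- The same against scorer B's printed bar: `V(W) < N · δτ_B(τ_int, W, N)²` for every `W` and
every `N > 0`, when `ρ ≥ 0`. -/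
theorem tauHatAVar_lt_msDTau_sq {ρ : ℕ → ℝ} (hρ : Summable ρ) (h0 : ρ 0 = 1) (hnn : ∀ t, 0 ≤ ρ t)
    (hτ : tauInt ρ ≠ 0) (W : ℕ) {N : ℝ} (hN : 0 < N) :
    tauHatAVar ρ W < N * msDTau (tauInt ρ) W N ^ 2 := by
  rw [natCast_mul_msDTau_sq (Nat.cast_nonneg W) hN]
  exact tauHatAVar_lt_printed hρ h0 hnn hτ W

/-- `V(W) ≥ 0` for `ρ ≥ 0` (a sum of non-negative kernels). -/
theorem tauHatAVar_nonneg {ρ : ℕ → ℝ} (hnn : ∀ t, 0 ≤ ρ t) (W : ℕ) : 0 ≤ tauHatAVar ρ W :=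
  sum_nonneg fun _ _ => sum_nonneg fun _ _ => bartlettKernel_nonneg (fun _ => hnn _) _ _

end Summit.Ventures.LatticeQCDFlow.Scoring
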